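import Mathlib
import Literature.Computability.AlgebraicComplexity.JointCircuits
import Literature.Computability.AlgebraicComplexity.FFTCircuitCost
import HarnessLib

/-!
# Fast division with remainder by a constant monic polynomial, as a circuit

Topic `Computability/AlgebraicComplexity`, namespace `Literature.Computability.AlgebraicComplexity`.
Everything PROVED; bookkeeping definitions only (`revInvCoeff`, `divCoeff`, `modStepCost`), no
named facts.

Setting (von zur Gathen–Gerhard §9.1, "division with remainder using Newton iteration"): a
polynomial `B` of degree `< 2m` over the ring of circuit NODES `k[X_τ]` is divided by a MONIC
polynomial `P = p.map C` of degree `m` whose coefficients are CONSTANTS (`p ∈ k[X]`).  Writing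
`rev` for coefficient reversal, `rev(B) ≡ rev(Q) · rev(P) (mod X^m)` for the quotient `Q`, so
`rev(Q) = rev(B) · rev(P)^{-1} mod X^m`; since `rev(P)^{-1}` is a CONSTANT power series (free in
Bürgisser's model), the `m` coefficients of `Q` are one linear convolution of the top `m`
coefficients of `B` with constants, and `R = B − Q·P` (degree `< m`) is a second linear convolution
with constants and `m` subtractions:

* `revInvCoeff p` — the coefficients `s_i` of `rev(p)^{-1}` (`Σ_{l ≤ u} p_{m-l} s_{u-l} = [u = 0]`,
  `sum_coeff_mul_revInvCoeff`);
* `divCoeff` — the quotient coefficients `q_j = Σ_{i < m-j} s_i b_{m+j+i}`; `modByMonic_eq_sub`: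
  `B %ₘ P = B − Q·P`; `coeff_modByMonic` : `(B %ₘ P)_e = b_e − Σ_{j+l=e} q_j p_l`;
  `divCoeff_eq_lconv` : `q_j` is a linear convolution of the reversed top block of `B` with the `s_i`;
* `jointlyComputed_modByMonic` — the circuit: if the `2^{K+1}` coefficients of `B` are read off a
  jointly computed family, so are the `2^K` coefficients of `B %ₘ P` (`deg P = 2^K`) within
  `modStepCost K = 2(3K+5)2^{K+1} + 2^K` further gates (two fast multiplications
  `jointlyComputed_lconv`, `FFTCircuitCost.lean`, and `2^K` weighted additions).

This is the building block of the remainder tree for fast multipoint evaluation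
(`MultipointEvaluationCircuit.lean`).

## References

* J. von zur Gathen, J. Gerhard, *Modern Computer Algebra*, CUP (3rd ed. 2013), §9.1
  (Algorithm 9.5, Thm 9.6: fast division with remainder). [GathenGerhard2013]
* [Burgisser2000] P. Bürgisser, *Completeness and Reduction in Algebraic Complexity Theory*,
  Springer 2000, Def. 2.1 (the circuit model; constants are free).
-/

noncomputable section

open MvPolynomial

namespace Literature.Computability.AlgebraicComplexity

section Division

universe uu vv ww

variable {k : Type uu} [CommRing k]

open _root_.Finset _root_.Polynomial

/-! ### The reversed inverse of a monic polynomial -/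

/-- The coefficients `s_i` of `rev(p)^{-1} ∈ k⟦X⟧`, `rev(p) = Σ_l p_{m-l} X^l` (`m = deg p`,
constant term `p_m = 1` for monic `p`). [cite: GathenGerhard2013, §9.1 Algorithm 9.5] -/
def revInvCoeff (p : k[X]) (i : ℕ) : k :=
  PowerSeries.coeff i
    ((PowerSeries.mk fun l => p.coeff (p.natDegree - l)).invOfUnit 1)

/-- `Σ_{l ≤ u} p_{m-l} · s_{u-l} = [u = 0]` (`rev(p) · rev(p)^{-1} = 1`, coefficient `u`).
[cite: GathenGerhard2013, §9.1 Algorithm 9.5] -/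
theorem sum_coeff_mul_revInvCoeff (p : k[X]) (hp : p.Monic) (u : ℕ) :
    ∑ l ∈ range (u + 1), p.coeff (p.natDegree - l) * revInvCoeff p (u - l) =
      if u = 0 then 1 else 0 := by
  set φ : PowerSeries k := PowerSeries.mk fun l => p.coeff (p.natDegree - l) with hφ
  have hc : PowerSeries.constantCoeff φ = ((1 : kˣ) : k) := by
    rw [Units.val_one, hφ, PowerSeries.constantCoeff_mk, Nat.sub_zero]
    exact hp.coeff_natDegree
  have h := congrArg (PowerSeries.coeff u) (PowerSeries.mul_invOfUnit φ 1 hc)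
  rw [PowerSeries.coeff_mul, PowerSeries.coeff_one,
    Nat.sum_antidiagonal_eq_sum_range_succ_mk] at h
  rw [← h]
  refine sum_congr rfl fun l _ => ?_
  rw [hφ, PowerSeries.coeff_mk]
  rfl

/-! ### The quotient and the remainder -/

variable {S : Type vv} [CommRing S] (f : k →+* S) (p : k[X]) (B : S[X])

/-- The quotient coefficients `q_j = Σ_{i < m-j} s_i · b_{m+j+i}` (`j < m`; `0` for `j ≥ m`) of
`B` (degree `< 2m`) by `P = p.map f` (monic, degree `m`). [cite: GathenGerhard2013, §9.1 Algorithm 9.5] -/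
def divCoeff (j : ℕ) : S :=
  if j < p.natDegree then
    ∑ i ∈ range (p.natDegree - j), f (revInvCoeff p i) * B.coeff (p.natDegree + j + i)
  else 0

/-- The quotient polynomial `Q = Σ_{j<m} q_j X^j` has coefficients `divCoeff`.
[cite: GathenGerhard2013, §9.1 Algorithm 9.5] -/
theorem coeff_divPoly (j : ℕ) :
    (∑ j' ∈ range p.natDegree, Polynomial.C (divCoeff f p B j') * Polynomial.X ^ j').coeff j =
      divCoeff f p B j := by
  rw [finsetSum_coeff]
  simp only [coeff_C_mul_X_pow, sum_ite_eq, mem_range]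
  unfold divCoeff
  split_ifs <;> rfl

/-- **The top coefficients match**: `coeff_{m+kk}(Q · P) = b_{m+kk}` for `kk < m` — the triangular
Toeplitz system solved by `rev(p)^{-1}`. [cite: GathenGerhard2013, §9.1 Thm 9.6] -/
theorem coeff_divPoly_mul (hp : p.Monic) (kk : ℕ) (hkk : kk < p.natDegree) :
    ((∑ j' ∈ range p.natDegree, Polynomial.C (divCoeff f p B j') * Polynomial.X ^ j') *
        p.map f).coeff (p.natDegree + kk) = B.coeff (p.natDegree + kk) := by
  set m := p.natDegree with hm
  set Q : S[X] := ∑ j' ∈ range m, Polynomial.C (divCoeff f p B j') * Polynomial.X ^ j' with hQ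
  have hQc : ∀ j, Q.coeff j = divCoeff f p B j := coeff_divPoly f p B
  rw [Polynomial.coeff_mul, Nat.sum_antidiagonal_eq_sum_range_succ_mk]
  -- only `kk ≤ j < m` contribute
  have hrestrict : ∑ j ∈ range (m + kk).succ, Q.coeff (j, m + kk - j).1 * (p.map f).coeff (j, m + kk - j).2
      = ∑ j ∈ Ico kk m, Q.coeff j * (p.map f).coeff (m + kk - j) := by
    refine (sum_subset (fun j hj => ?_) (fun j hj hj' => ?_)).symm
    · rw [mem_Ico] at hj; rw [mem_range]; omega
    · rw [mem_range] at hj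
      rw [mem_Ico, not_and_or, not_le, not_lt] at hj'
      simp only
      rcases hj' with hlt | hge
      · -- `j < kk`: the `p`-coefficient index exceeds `m`
        rw [Polynomial.coeff_map, coeff_eq_zero_of_natDegree_lt (by omega : p.natDegree < m + kk - j),
          map_zero, mul_zero]
      · rw [hQc]; unfold divCoeff; rw [if_neg (by omega), zero_mul]
  rw [hrestrict, sum_Ico_eq_sum_range]
  -- substitute the quotient coefficients and flip the triangle
  have hterm : ∀ l ∈ range (m - kk), Q.coeff (kk + l) * (p.map f).coeff (m + kk - (kk + l)) =
      ∑ i ∈ range (m - kk - l), f (p.coeff (m - l)) * f (revInvCoeff p i) *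
        B.coeff (m + kk + (l + i)) := by
    intro l hl
    rw [mem_range] at hl
    rw [hQc, Polynomial.coeff_map, show m + kk - (kk + l) = m - l by omega]
    unfold divCoeff
    rw [if_pos (by omega), show m - (kk + l) = m - kk - l by omega, sum_mul]
    refine sum_congr rfl fun i _ => ?_
    rw [show m + (kk + l) + i = m + kk + (l + i) by ring]
    ring
  rw [sum_congr rfl hterm, ← sum_range_diag_flip]
  -- the inner sums are `b_{m+kk+u} · f([u = 0])`
  have hinner : ∀ u ∈ range (m - kk),
      ∑ l ∈ range (u + 1), f (p.coeff (m - l)) * f (revInvCoeff p (u - l)) *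
        B.coeff (m + kk + (l + (u - l))) =
      B.coeff (m + kk + u) * f (if u = 0 then 1 else 0) := by
    intro u _
    rw [← sum_coeff_mul_revInvCoeff p hp u, map_sum, mul_sum]
    refine sum_congr rfl fun l hl => ?_
    rw [mem_range] at hl
    rw [show l + (u - l) = u by omega, map_mul]
    ring
  rw [sum_congr rfl hinner]
  have h0 : 0 ∈ range (m - kk) := by rw [mem_range]; omega
  rw [sum_eq_single_of_mem 0 h0 (fun u _ hu => by rw [if_neg hu, map_zero, mul_zero]),
    if_pos rfl, map_one, mul_one, Nat.add_zero]

/-- **Division with remainder**: for `P = p.map f` monic of degree `m` and `deg B < 2m`,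
`B %ₘ P = B − Q · P` with `Q = Σ_{j<m} q_j X^j`. [cite: GathenGerhard2013, §9.1 Thm 9.6] -/
theorem modByMonic_eq_sub [Nontrivial S] (hp : p.Monic) (hm0 : 0 < p.natDegree)
    (hB : ∀ i, 2 * p.natDegree ≤ i → B.coeff i = 0) :
    B %ₘ p.map f =
      B - (∑ j' ∈ range p.natDegree, Polynomial.C (divCoeff f p B j') * Polynomial.X ^ j') *
        p.map f := by
  set m := p.natDegree with hm
  set Q : S[X] := ∑ j' ∈ range m, Polynomial.C (divCoeff f p B j') * Polynomial.X ^ j' with hQ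
  have hPm : (p.map f).Monic := hp.map f
  have hPdeg : (p.map f).natDegree = m := hp.natDegree_map f
  have hQdeg : Q.natDegree ≤ m - 1 := by
    refine natDegree_sum_le_of_forall_le _ _ fun j hj => ?_
    rw [mem_range] at hj
    exact (natDegree_C_mul_X_pow_le _ _).trans (by omega)
  refine (div_modByMonic_unique Q (B - Q * p.map f) hPm ⟨by ring, ?_⟩).2
  rw [degree_eq_natDegree hPm.ne_zero, hPdeg, degree_lt_iff_coeff_zero]
  intro e he
  rw [Polynomial.coeff_sub]
  rcases Nat.lt_or_ge e (2 * m) with hlt | hge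
  · obtain ⟨kk, rfl⟩ : ∃ kk, e = m + kk := ⟨e - m, by omega⟩
    rw [coeff_divPoly_mul f p B hp kk (by omega), sub_self]
  · rw [hB e hge, zero_sub, neg_eq_zero]
    refine coeff_eq_zero_of_natDegree_lt ?_
    calc (Q * p.map f).natDegree ≤ Q.natDegree + (p.map f).natDegree := natDegree_mul_le
      _ < e := by rw [hPdeg]; omega

/-- **The coefficients of the remainder**: `(B %ₘ P)_e = b_e − Σ_{j+l=e} q_j · f(p_l)` — a linear
convolution of the quotient coefficients with the constants `p_l`.
[cite: GathenGerhard2013, §9.1 Thm 9.6] -/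
theorem coeff_modByMonic [Nontrivial S] (hp : p.Monic) (hm0 : 0 < p.natDegree)
    (hB : ∀ i, 2 * p.natDegree ≤ i → B.coeff i = 0) (e : ℕ) :
    (B %ₘ p.map f).coeff e =
      B.coeff e - lconv (divCoeff f p B) (fun l => f (p.coeff l)) e := by
  rw [modByMonic_eq_sub f p B hp hm0 hB, Polynomial.coeff_sub, Polynomial.coeff_mul]
  congr 1
  unfold lconv
  refine sum_congr rfl fun x _ => ?_
  rw [coeff_divPoly, Polynomial.coeff_map]

/-- **The quotient coefficients are a linear convolution**: with `a_i = b_{2m-1-i}` (`i < m`, the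
reversed top block) and `s'_i = f(s_i)` (`i < m`), `q_j = (a ∗ s')_{m-1-j}` for `j < m`.
[cite: GathenGerhard2013, §9.1 Algorithm 9.5] -/
theorem divCoeff_eq_lconv (j : ℕ) (hj : j < p.natDegree) :
    divCoeff f p B j =
      lconv (fun i => if i < p.natDegree then B.coeff (2 * p.natDegree - 1 - i) else 0)
        (fun i => if i < p.natDegree then f (revInvCoeff p i) else 0) (p.natDegree - 1 - j) := by
  set m := p.natDegree with hm
  unfold divCoeff lconv
  rw [if_pos hj, ← Nat.sum_antidiagonal_swap, Nat.sum_antidiagonal_eq_sum_range_succ_mk]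
  have hsucc : (m - 1 - j).succ = m - j := by omega
  rw [hsucc]
  refine sum_congr rfl fun i hi => ?_
  rw [mem_range] at hi
  simp only [Prod.swap_prod_mk]
  rw [if_pos (by omega), if_pos (by omega), show 2 * m - 1 - (m - 1 - j - i) = m + j + i by omega,
    mul_comm]

/-! ### The circuit -/

variable {τ : Type ww}

/-- Gate count of one fast division step at size `2^K` (remainder of a node polynomial of degree
`< 2^{K+1}` by a constant monic polynomial of degree `2^K`): two fast multiplications with
transform length `2^{K+1}` and `2^K` subtractions. [cite: GathenGerhard2013, §9.1 Thm 9.6] -/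
def modStepCost (K : ℕ) : ℕ := 2 * ((3 * (K + 1) + 2) * 2 ^ (K + 1)) + 2 ^ K

/-- `modStepCost K = (12K + 21) 2^K`. [cite: GathenGerhard2013, §9.1 Thm 9.6] -/
theorem modStepCost_eq (K : ℕ) : modStepCost K = (12 * K + 21) * 2 ^ K := by
  rw [modStepCost, pow_succ]; ring

/-- **Fast division by a constant monic polynomial, as a circuit** (GG Thm 9.6, cost part, in
Bürgisser's model where the constants `s_i`, `p_l` are free): if the `2^{K+1}` coefficients of
`B ∈ k[X_τ][X]` (`b_i = 0` for `i ≥ 2^{K+1}`) are read off a jointly computed family within `s`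
gates and `p ∈ k[X]` is monic of degree `2^K`, then the `2^K` coefficients of `B %ₘ p.map C` are
jointly computed within `s + modStepCost K` gates (`ζ^{2^K} = −1`, `2^{K+1} · tinv = 1`).
[cite: GathenGerhard2013, §9.1 Thm 9.6] -/
theorem jointlyComputed_modByMonic [Nontrivial k] {ι : Type*} {v : ι → MvPolynomial τ k} {s : ℕ}
    (hv : JointlyComputed v s) (K : ℕ) {ζ tinv : k}
    (hζ : ζ ^ 2 ^ (K + 1 - 1) = -1) (ht : (2 ^ (K + 1) : k) * tinv = 1)
    (p : k[X]) (hp : p.Monic) (hdeg : p.natDegree = 2 ^ K)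
    (B : (MvPolynomial τ k)[X]) (hB : ∀ i, 2 ^ (K + 1) ≤ i → B.coeff i = 0)
    (eB : Fin (2 ^ (K + 1)) → ι) (heB : ∀ i, v (eB i) = B.coeff i) :
    JointlyComputed (Sum.elim v (fun e : Fin (2 ^ K) => (B %ₘ p.map MvPolynomial.C).coeff e))
      (s + modStepCost K) := by
  classical
  set m := p.natDegree with hm
  have hm2 : 2 * m = 2 ^ (K + 1) := by rw [hdeg, pow_succ]; ring
  have hB' : ∀ i, 2 * p.natDegree ≤ i → B.coeff i = 0 := fun i hi => hB i (by omega)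
  -- the reversed top block (members) and the constants
  let a : ℕ → MvPolynomial τ k := fun i => if i < m then B.coeff (2 * m - 1 - i) else 0
  let sc : ℕ → MvPolynomial τ k := fun i => if i < m then MvPolynomial.C (revInvCoeff p i) else 0
  let pc : ℕ → MvPolynomial τ k := fun l => MvPolynomial.C (p.coeff l)
  let w : ι ⊕ (Fin m ⊕ (Fin m ⊕ Fin (m + 1))) → MvPolynomial τ k :=
    Sum.elim v (Sum.elim (fun i => a i) (Sum.elim (fun i => sc i) (fun l => pc l)))
  have hw : JointlyComputed w s := by
    refine hv.of_mem _ ?_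
    rintro (x | (i | (i | l)))
    · exact Or.inl ⟨x, rfl⟩
    · refine Or.inl ⟨eB ⟨2 * m - 1 - i, by omega⟩, ?_⟩
      simp [w, a, heB]
    · exact Or.inr (Or.inr ⟨revInvCoeff p i, by simp [w, sc]⟩)
    · exact Or.inr (Or.inr ⟨p.coeff l, by simp [w, pc]⟩)
  -- first fast multiplication: the quotient coefficients
  have hK1 : K + 1 ≠ 0 := Nat.succ_ne_zero _
  have h1 := jointlyComputed_lconv hw hK1 hζ ht a sc (la := m) (lb := m)
    (fun i hi => by simp [a, not_lt.2 hi]) (fun i hi => by simp [sc, not_lt.2 hi]) (by omega)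
    (fun i => Sum.inr (Sum.inl i)) (fun i => Sum.inr (Sum.inr (Sum.inl i)))
    (fun i => rfl) (fun i => rfl)
  have hq : ∀ j : Fin m, lconv a sc (⟨m - 1 - j, by omega⟩ : Fin (2 ^ (K + 1))) =
      divCoeff MvPolynomial.C p B j := by
    intro j
    exact (divCoeff_eq_lconv MvPolynomial.C p B j j.isLt).symm
  -- second fast multiplication: `Q · P`
  have h2 := jointlyComputed_lconv h1 hK1 hζ ht (divCoeff MvPolynomial.C p B) pc
    (la := m) (lb := m + 1)
    (fun j hj => by unfold divCoeff; rw [if_neg (not_lt.2 hj)])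
    (fun l hl => by
      simp only [pc]
      rw [coeff_eq_zero_of_natDegree_lt (by omega), MvPolynomial.C_0]) (by omega)
    (fun j => Sum.inr ⟨m - 1 - j, by omega⟩)
    (fun l => Sum.inl (Sum.inr (Sum.inr (Sum.inr l))))
    (fun j => by rw [Sum.elim_inr, hq]) (fun l => rfl)
  -- the subtractions
  have h3 := h2.extend_wadd (κ := Fin m) (fun _ => (1 : k)) (fun _ => (-1 : k))
    (fun e => Sum.inl (Sum.inl (Sum.inl (eB ⟨e, by omega⟩))))
    (fun e => Sum.inr ⟨e, by omega⟩)
  rw [Fintype.card_fin] at h3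
  have hcost : s + (3 * (K + 1) + 2) * 2 ^ (K + 1) + (3 * (K + 1) + 2) * 2 ^ (K + 1) + m =
      s + modStepCost K := by rw [modStepCost, hdeg]; ring
  rw [hcost] at h3
  refine h3.of_mem _ ?_
  rintro (x | e)
  · exact Or.inl ⟨Sum.inl (Sum.inl (Sum.inl (Sum.inl x))), rfl⟩
  · refine Or.inl ⟨Sum.inr ⟨e, by omega⟩, ?_⟩
    simp only [Sum.elim_inr, Sum.elim_inl, one_smul, neg_one_smul]
    rw [coeff_modByMonic MvPolynomial.C p B hp (by rw [← hm, hdeg]; exact Nat.one_le_two_pow) hB' e,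
      sub_eq_add_neg]
    simp [w, pc, heB]

end Division

end Literature.Computability.AlgebraicComplexity

end
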